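import Mathlib
import Summits.ValiantsHypothesis.ValiantsHypothesis.Theorems.NewtonTauWeak.Negative.Zonogon
import Summits.ValiantsHypothesis.ValiantsHypothesis.Theorems.NewtonUnitEquationsNewtonTauWeakSeparatedRank
import Summits.ValiantsHypothesis.ValiantsHypothesis.Theorems.NewtonUnitEquationsNewtonTauWeakVdpDefs
import Summits.ValiantsHypothesis.ValiantsHypothesis.Theorems.NewtonUnitEquationsNewtonTauWeakStubVertexCharts
import Summits.ValiantsHypothesis.ValiantsHypothesis.Theorems.NewtonUnitEquationsNewtonTauWeakStubChartPairCount
import Summits.ValiantsHypothesis.ValiantsHypothesis.Theorems.NewtonUnitEquationsNewtonTauWeakStubProductVertices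
import Summits.ValiantsHypothesis.ValiantsHypothesis.Theorems.NewtonUnitEquationsNewtonTauWeakHexagonPlanar

/-!
# `NewtonUnitEquationsNewtonTauWeakHexagonUnion`

Rung toward `stub_binomialNewtonTauCommon` (T2 = KPTT Conj. 1 at `t = 2`; crux `NewtonTauWeak`,
stmt-ValiantsHypothesis-5904), line `binomial-normal-form`, lead c3: the ALL-`K` hexagon theorem `H_K`
("`vert(Σ_{l<K} X_l(x)Y_l(y)D_l(xy)) ≤ C(K)`, degree-free") via the HOMOGENEOUS Wronskian equation
(card `Cruxes/NewtonTauWeak/Lines/binomial-normal-form-delta-global.md` §2).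

This file: `hex_ncard_chartTops_iUnion_le` — chart tops of a polynomial whose support is the union of the supports of a finite family number at most the sum of the Newton-vertex counts of the family (the `Fin n` version of the landed `hex_ncard_chartTops_union_le`, …HexagonPlanar.lean: a top of `U` lying in `supp Mᵢ` is a top of `Mᵢ`, `hex_isTop_of_support_eq_union`; tops are vertices, `ChartPairCount.ncard_tops_le`).

Conventions (inline, no definitions): `Δ` is ANY self-map of `ℂ[X,Y]` with `coeff e (Δ p) = (e₀ - e₁) · coeff e p`;
"x-only" `∀ e ∈ P.support, e 1 = 0`, "y-only" `e 0 = 0`, "diagonal" `e 0 = e 1`; "separated of rank R":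
`m = Σ_{r<R} P_r·Q_r` with `P_r` x-only, `Q_r` y-only. [folklore]
-/

set_option linter.dupNamespace false

noncomputable section

namespace Summit.ValiantsHypothesis.ValiantsHypothesis.Theorems.NewtonUnitEquationsNewtonTauWeak

open scoped BigOperators
open MvPolynomial
open Literature.Computability.AlgebraicComplexity (newtonVertexCount)
open Summit.ValiantsHypothesis.ValiantsHypothesis.Theorems.NewtonTauWeakVdp
open Summit.ValiantsHypothesis.ValiantsHypothesis.Theorems.NewtonTauWeak.Negative (vert)

/-- H7 **Chart tops of a union-support polynomial, any number of pieces.** [folklore] -/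
theorem hex_ncard_chartTops_iUnion_le (σ : ℝ) {n : ℕ} (U : MvPolynomial (Fin 2) ℂ)
    (M : Fin n → MvPolynomial (Fin 2) ℂ) (hU : ∀ e, e ∈ U.support ↔ ∃ i, e ∈ (M i).support) :
    {z : Fin 2 →₀ ℕ | ∃ t : ℝ, IsGeneric ![σ, t] ∧ IsTop ![σ, t] U z}.ncard ≤ ∑ i, newtonVertexCount (M i) := by
  have hMU : ∀ i, (M i).support ⊆ U.support := fun i e he => (hU e).2 ⟨i, he⟩
  have hsub : {z : Fin 2 →₀ ℕ | ∃ t : ℝ, IsGeneric ![σ, t] ∧ IsTop ![σ, t] U z} ⊆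
      ⋃ i, {b | ∃ w : Fin 2 → ℝ, IsTop w (M i) b} := by
    rintro z ⟨t, -, hz⟩
    obtain ⟨i, hi⟩ := (hU z).1 hz.mem
    exact Set.mem_iUnion.2 ⟨i, _, (hex_isTop_of_support_eq_union (hMU i) hz).2 hi⟩
  calc {z : Fin 2 →₀ ℕ | ∃ t : ℝ, IsGeneric ![σ, t] ∧ IsTop ![σ, t] U z}.ncard
      ≤ (⋃ i, {b | ∃ w : Fin 2 → ℝ, IsTop w (M i) b}).ncard :=
        Set.ncard_le_ncard hsub (Set.finite_iUnion fun i => ChartPairCount.tops_finite (M i))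
    _ ≤ ∑ i, {b | ∃ w : Fin 2 → ℝ, IsTop w (M i) b}.ncard := Set.ncard_iUnion_le_of_fintype _
    _ ≤ ∑ i, newtonVertexCount (M i) :=
        Finset.sum_le_sum fun i _ => ChartPairCount.ncard_tops_le (M i)

/-- **Vertices of a union-support polynomial, any number of pieces**: `V(U) ≤ 2 · Σᵢ V(Mᵢ)`
(the `Fin n` version of `hex_newtonVertexCount_union_le`, via `stub_vertexCharts`). [folklore] -/
theorem hex_newtonVertexCount_iUnion_le {n : ℕ} (U : MvPolynomial (Fin 2) ℂ)
    (M : Fin n → MvPolynomial (Fin 2) ℂ) (hU : ∀ e, e ∈ U.support ↔ ∃ i, e ∈ (M i).support) :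
    newtonVertexCount U ≤ 2 * ∑ i, newtonVertexCount (M i) := by
  have h := stub_vertexCharts U
  have hp := hex_ncard_chartTops_iUnion_le 1 U M hU
  have hm := hex_ncard_chartTops_iUnion_le (-1) U M hU
  omega


end Summit.ValiantsHypothesis.ValiantsHypothesis.Theorems.NewtonUnitEquationsNewtonTauWeak

end
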